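import Summits.AtomisticToContinuum.Crystallization.Theorems.PerronTransitivityFractionalGainGivesTransitivity

/-!
# Crux `TransitiveLocalLimit` (stmt-AtomisticToContinuum-15100), line `registered`:
# the WEAKEST copositive hypothesis the line uses — K* on Lennard-Jones ground states only

The landed K*-conditional stub 1 `superBoundSparse_of_noFractionalGain` applies the route's crux
`NoFractionalGain` (stmt-AtomisticToContinuum-15098: the copositive inequality
`2E*·Σ cᵢ² ≤ Σᵢ Σ_{j≠i} cᵢcⱼ V_LJ(|xᵢ − xⱼ|)` for EVERY injective finite configuration `x` of `ℝ³` and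
every `c ≥ 0`) only to the ground states `x N` themselves.  This file records the reduction under the
correspondingly weaker hypothesis — the same inequality for Lennard-Jones GROUND STATES only
(`hK` below; implied by `NoFractionalGain`, and by any `δ`-separated form of K* with `δ` at most the
minimal distance of ground states, the restatement the route's kill criteria foresee) — so that a
restated K* still closes the crux through the registered line:

* `superBoundSparse_of_copositive_groundStates` — the registered signature of `stub_superBoundSparse`
  under `hK`;
* `transitiveLocalLimit_of_copositive_groundStates` — hence the crux `TransitiveLocalLimit`, by the
  landed composition `TransitiveLocalLimit_of_parts` and the landed stubs 2–4;
* (`NoFractionalGain` implies `hK` by `fun N x hx c hc => hK N x hx.1 c hc`; the landed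
  `transitiveLocalLimit_of_noFractionalGain` is that composite, not restated here).

Proofs: verbatim those of `superBoundSparse_of_noFractionalGain` (`card_superBound_le_of_copositive` on
each ground state with the uniform constant of `LennardJonesMinimalDistance_holds`, then
`crysEnergyLimit`). All [folklore] given the hypothesis.
-/

noncomputable section

namespace Summit.AtomisticToContinuum.Crystallization.Theorems.TransitiveLocalLimitBirth

open Filter Literature.MathematicalPhysics.StatisticalMechanics
open scoped BigOperators

/-- **Stub 1 under K* on ground states.** If the copositive inequality
`2E*·Σ cᵢ² ≤ Σᵢ Σ_{j≠i} cᵢcⱼ V_LJ(|xᵢ − xⱼ|)` holds for every Lennard-Jones GROUND STATE `x` of `ℝ³` and all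
weights `c ≥ 0` (`E* = ⨅_Q e_LJ(Q)`), then along every sequence of Lennard-Jones ground states and for
every `θ > 0` the `θ`-super-bound sites (`𝓔ⁱ ≤ 2E* − θ`) have density `→ 0` — the registered signature
of `stub_superBoundSparse`. [folklore] -/
theorem superBoundSparse_of_copositive_groundStates : (∀ (N : ℕ) (x : Fin N → EuclideanSpace ℝ (Fin 3)), Literature.MathematicalPhysics.StatisticalMechanics.IsGroundState Literature.MathematicalPhysics.StatisticalMechanics.lennardJones x → ∀ c : Fin N → ℝ, (∀ i, 0 ≤ c i) → 2 * (⨅ Q : Literature.MathematicalPhysics.StatisticalMechanics.PeriodicConfiguration 3, Q.energyPerParticle Literature.MathematicalPhysics.StatisticalMechanics.lennardJones) * ∑ i, c i ^ 2 ≤ ∑ i, ∑ j ∈ Finset.univ.erase i, c i * c j * Literature.MathematicalPhysics.StatisticalMechanics.lennardJones (dist (x i) (x j))) → ∀ x : (N : ℕ) → (Fin N → EuclideanSpace ℝ (Fin 3)), (∀ N, Literature.MathematicalPhysics.StatisticalMechanics.IsGroundState Literature.MathematicalPhysics.StatisticalMechanics.lennardJones (x N)) → ∀ θ : ℝ, 0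 < θ → Filter.Tendsto (fun N : ℕ => ((Finset.univ.filter fun i : Fin N => Literature.MathematicalPhysics.StatisticalMechanics.siteEnergy Literature.MathematicalPhysics.StatisticalMechanics.lennardJones (x N) i ≤ 2 * (⨅ Q : Literature.MathematicalPhysics.StatisticalMechanics.PeriodicConfiguration 3, Q.energyPerParticle Literature.MathematicalPhysics.StatisticalMechanics.lennardJones) - θ).card : ℝ) / N) Filter.atTop (nhds 0) := by
  intro hK x hx θ hθ
  set E : ℝ := ⨅ Q : PeriodicConfiguration 3, Q.energyPerParticle lennardJones with hE
  obtain ⟨δ, hδ, hδsep⟩ := LennardJonesMinimalDistance_holds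
  set C : ℝ := (δ⁻¹ ^ 6 / 12 + 1 / 6) * (250 * δ⁻¹ ^ 6) with hC
  have hC0 : 0 < C := by positivity
  set A : ℝ := C + 2 * |E| with hA
  -- finite-`N` bound on every ground state
  have hcard : ∀ N, ((Finset.univ.filter fun i : Fin N =>
      siteEnergy lennardJones (x N) i ≤ 2 * E - θ).card : ℝ) ≤
        2 * A / θ ^ 2 * (groundStateEnergy lennardJones 3 N - N * E) := fun N => by
    rw [← (hx N).2]
    refine card_superBound_le_of_copositive (x N) hC0 (fun i => ?_) hθ fun c hc => ?_
    · exact sum_abs_lennardJones_erase_le (x N) hδ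
        (fun k l hkl => hδsep N (x N) (hx N) k l hkl) i
    · exact hK N (x N) (hx N) c hc
  -- the comparison sequence tends to `0`
  have hlim : Tendsto (fun N : ℕ => 2 * A / θ ^ 2 * (groundStateEnergy lennardJones 3 N / N - E))
      atTop (nhds 0) := by
    have h := (Summit.AtomisticToContinuum.Crystallization.Theorems.ChargedEnergyGapNegative.crysEnergyLimit).sub_const E
    rw [sub_self] at h
    simpa using h.const_mul (2 * A / θ ^ 2)
  refine squeeze_zero' (Eventually.of_forall fun N => by positivity) ?_ hlim
  filter_upwards [eventually_ge_atTop 1] with N hN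
  have hN : (0 : ℝ) < N := by exact_mod_cast hN
  rw [div_le_iff₀ hN]
  have := hcard N
  calc ((Finset.univ.filter fun i : Fin N => siteEnergy lennardJones (x N) i ≤ 2 * E - θ).card : ℝ)
      ≤ 2 * A / θ ^ 2 * (groundStateEnergy lennardJones 3 N - N * E) := this
    _ = 2 * A / θ ^ 2 * (groundStateEnergy lennardJones 3 N / N - E) * N := by
        field_simp

/-- **The crux under K* on ground states**: the copositive inequality on Lennard-Jones ground states
alone already gives `TransitiveLocalLimit`, through the landed composition `TransitiveLocalLimit_of_parts`
of the registered line and the landed stubs 2–4. [folklore] -/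
theorem transitiveLocalLimit_of_copositive_groundStates
    (hK : ∀ (N : ℕ) (x : Fin N → EuclideanSpace ℝ (Fin 3)), IsGroundState lennardJones x →
      ∀ c : Fin N → ℝ, (∀ i, 0 ≤ c i) →
        2 * (⨅ Q : PeriodicConfiguration 3, Q.energyPerParticle lennardJones) * ∑ i, c i ^ 2 ≤
          ∑ i, ∑ j ∈ Finset.univ.erase i, c i * c j * lennardJones (dist (x i) (x j))) :
    Summit.AtomisticToContinuum.Crystallization.Theses.PerronTransitivity.TransitiveLocalLimit :=
  TransitiveLocalLimit_of_parts (superBoundSparse_of_copositive_groundStates hK)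
    stub_concentration_of_superBoundSparse stub_centredLocalLimit stub_siteEnergyContinuity

end Summit.AtomisticToContinuum.Crystallization.Theorems.TransitiveLocalLimitBirth

end
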